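import Mathlib
import Summits.MatrixMultiplication.MatrixMultiplication.Theses.ThinBlockAlpha
import Summits.MatrixMultiplication.MatrixMultiplication.Theorems.ThinBlockAlphaRectangularThmBChartSTPP

/-!
# Census companion gen 5 — the TYPED-DELETION ENGINE for carry charts: typed, composed, and KILLED
(crux `ThinBlockAlpha.ThinPackings`, stmt-MatrixMultiplication-10595; strategist planner-cstrat-stmt-MatrixMultiplication-10595-p5-0,
2026-08-17; see `STRATEGY-CENSUS.md` gen 5 §T23, §S20, §D34, §N29).  SORRY-FREE: every statement that would have been a
stub is a named `Prop` (`Stmt.*`) used as a HYPOTHESIS; nothing here is registered as a line.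

WHAT WAS ATTEMPTED.  Replace the code engine of every chart-compiled design on this crux — tight Salem–Spencer hashing
(tree `exists_free_diagonal_jointType_card`, hypothesis `htight`), unavailable for CARRY relations in `ℤ/qⁿ` (carries
couple adjacent digits; no coordinatewise support) — by Erdős' ALTERATION method on the typed violation hypergraph:
keep each word of a type class `T` with probability `p`, delete one word per surviving bad triple; survivors
`≥ p|T| − p²B₂ − p³B₃` (`Stmt.typedDeletion`, an elementary true lemma), where `B₂`/`B₃` count the carry-solvable word
triples with a repeated word / three distinct words (`repeatBad`, `distinctBad`, values of the carry automaton
`CarrySolvable`).  Heart format: COUNTED carry charts (`Stmt.countedCarryCharts`), which refines the heart of line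
`cyclic-carry-charts` (`carrySeeds_of`) and composes with its compiler statement to the crux BY NAME (`thinPackings_of`);
the same engine composes with the tree's PROVED CKSU compiler `stub_chartSTPP` (`thinPackings_of_homocyclicCounts`).

WHY IT IS DEAD (census gen 5).  With `|T| = 2^{nH}`, `B₂ = 2^{nH₂}`, `B₃ = 2^{nH₃}` the optimal `p` gives code rate
`R_del = min(H, 2H − H₂, (3H − H₃)/2)`.  (i) Where tight hashing applies it gives `2H − max(H₂,H₃) + (H₃ − H)·[Γ=0…]`,
i.e. the FULL marginal entropy at zero penalty, and deletion is far below it (CKSU's USP chart: `R_del = 0.18` bits vs the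
USP capacity `0.918`; certified exponent `2.93` vs `2.41`, `calc/delrate.py`).  (ii) For ANY chart, `(x,x,z)` is solvable as
soon as the tiles `A_x − C_x`, `A_z − C_z` meet, so `R_del ≤ H₂-bound ≤ log₂(2q) − 2ℓ_A` — at most ONE bit above the thin
budget `log₂ q − 2ℓ_A`; and `H₃ ≥ H` forces `R_del ≤ (3H − H₃)/2 ≤ H` with near-equality only if almost no non-diagonal
symbol pattern is solvable, i.e. only if the symbol set is itself a near-tight near-STPP family in `ℤ/q` — the crux at the
base scale.  Alteration codes are `(a, η)`-NON-IMPROVING (skeleton calculus F9(c) for a third "engine"), so the counted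
heart is the crux in costume up to one bit.  (iii) The motivating analogy was false: Kleinberg–Sawin–Speyer's tight
tricolored sum-free sets (arXiv:1607.00047 §4, page-checked) are Behrend/Salem–Spencer HASHING on the tight support
`{a+b+c = q−1}` (integer sums: the Kummer slice of line `truncated-convolution-designs`), Norin–Pebody supplying only the
`S₃`-symmetric max-entropy type (penalty `0`) — not a hashing-free "type mismatch" engine.  (iv) Factorisation charts
(tight volume-`q` symbols = keyed digit tilings and their unit dilations) have EVERY pattern solvable, with or without
carries (`calc/factor_charts.py`: `c₂ = c₃ = 0` at `q = 27, 64, 125`): census N28.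

The definitions `digitVal` … `IsLocalCarryUSP` are VERBATIM copies of line `cyclic-carry-charts` (gen 1).
-/

set_option linter.dupNamespace false

namespace Summit.MatrixMultiplication.MatrixMultiplication.Cruxes.ThinPackings.CensusP5

open Finset Literature.Computability.AlgebraicComplexity
open Summit.MatrixMultiplication.MatrixMultiplication.Theses.ThinBlockAlpha (ThinPackings)
open Summit.MatrixMultiplication.MatrixMultiplication.Theorems (ChartSolvable SymbolTPP IsLocalChartUSP stub_chartSTPP)

/-! ## Definitions, part 1 — the carry-chart format (VERBATIM copies of line `cyclic-carry-charts`, gen 1) -/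

/-- Base-`q` digit map into the cyclic group `ℤ/qⁿ`: `(d_c)_{c<n} ↦ Σ_c d_c · q^c`. -/
def digitVal (q n : ℕ) (x : Fin n → ℕ) : ZMod (q ^ n) :=
  ∑ c : Fin n, (x c : ZMod (q ^ n)) * (q : ZMod (q ^ n)) ^ (c : ℕ)

/-- The leg of row `i` generated by the digit cells `cell : Γ → Finset ℕ`, pushed into `ℤ/qⁿ` by `digitVal`. -/
def carryLeg (q n : ℕ) {Γ : Type} (cell : Γ → Finset ℕ) {L : ℕ} (row : Fin L → Fin n → Γ) (i : Fin L) :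
    Finset (ZMod (q ^ n)) :=
  (Fintype.piFinset fun c => cell (row i c)).image (digitVal q n)

/-- All digits of all cells lie below the base `q`. -/
def CellsBelow (q : ℕ) {Γ : Type} (A B C : Γ → Finset ℕ) : Prop :=
  ∀ x : Γ, (∀ d ∈ A x, d < q) ∧ (∀ d ∈ B x, d < q) ∧ (∀ d ∈ C x, d < q)

/-- The signed column sum of the STPP relation `(s' − s) + (t' − t) + (u' − u)` on digits. -/
def colSum (s s' t t' u u' : ℕ) : ℤ := ((s' : ℤ) - s) + ((t' : ℤ) - t) + ((u' : ℤ) - u)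

/-- Per-symbol carry-TPP: a column sum of ONE symbol divisible by `q` forces equal digits. -/
def CarrySymbolTPP (q : ℕ) {Γ : Type} (A B C : Γ → Finset ℕ) (x : Γ) : Prop :=
  ∀ s ∈ A x, ∀ s' ∈ A x, ∀ t ∈ B x, ∀ t' ∈ B x, ∀ u ∈ C x, ∀ u' ∈ C x,
    (q : ℤ) ∣ colSum s s' t t' u u' → s = s' ∧ t = t' ∧ u = u'

/-- Carry-solvability of the ordered symbol-word triple `(x, y, z)` (= words of rows `i, j, k`, index pattern of the
tree's `IsSTPP`: `s ∈ A z, s' ∈ A x, t ∈ B x, t' ∈ B y, u ∈ C y, u' ∈ C z`): digits in the cells and an integer carry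
chain `κ` with `κ₀ = 0` and `e_c + κ_c = q κ_{c+1}` — equivalently the relation holds in `ℤ/qⁿ` (this equivalence is the
content of the compiler).  THE VIOLATION AUTOMATON of this line: states = carries, letters = symbol triples. -/
def CarrySolvable (q n : ℕ) {Γ : Type} (A B C : Γ → Finset ℕ) (x y z : Fin n → Γ) : Prop :=
  ∃ (s s' t t' u u' : Fin n → ℕ) (κ : Fin (n + 1) → ℤ),
    (∀ c, s c ∈ A (z c)) ∧ (∀ c, s' c ∈ A (x c)) ∧ (∀ c, t c ∈ B (x c)) ∧ (∀ c, t' c ∈ B (y c)) ∧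
    (∀ c, u c ∈ C (y c)) ∧ (∀ c, u' c ∈ C (z c)) ∧ κ 0 = 0 ∧
    ∀ c : Fin n, colSum (s c) (s' c) (t c) (t' c) (u c) (u' c) + κ c.castSucc = (q : ℤ) * κ c.succ

/-- **Local carry-chart USP**: no ordered triple of rows with indices not all equal is carry-solvable. -/
def IsLocalCarryUSP (q n : ℕ) {Γ : Type} (A B C : Γ → Finset ℕ) {L : ℕ} (row : Fin L → Fin n → Γ) : Prop :=
  ∀ i j k : Fin L, (i ≠ j ∨ j ≠ k) → ¬ CarrySolvable q n A B C (row i) (row j) (row k)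

/-! ## Definitions, part 2 — the typed violation hypergraph (NEW) -/

/-- The bad (carry-solvable, non-constant) ordered word triples inside a finite word set `T` (a type class, in the
intended use): the edge set of the VIOLATION HYPERGRAPH on `T`. -/
noncomputable def badTriples (q n : ℕ) {Γ : Type} (A B C : Γ → Finset ℕ) (T : Finset (Fin n → Γ)) :
    Finset ((Fin n → Γ) × (Fin n → Γ) × (Fin n → Γ)) := by
  classical
  exact (T ×ˢ T ×ˢ T).filter fun x => ¬ (x.1 = x.2.1 ∧ x.2.1 = x.2.2) ∧ CarrySolvable q n A B C x.1 x.2.1 x.2.2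

/-- Bad triples with a repeated word (the 2-uniform part: survival probability `p²` under `p`-sampling). -/
noncomputable def repeatBad (q n : ℕ) {Γ : Type} (A B C : Γ → Finset ℕ) (T : Finset (Fin n → Γ)) :
    Finset ((Fin n → Γ) × (Fin n → Γ) × (Fin n → Γ)) := by
  classical
  exact (badTriples q n A B C T).filter fun x => x.1 = x.2.1 ∨ x.2.1 = x.2.2 ∨ x.1 = x.2.2

/-- Bad triples of three distinct words (the 3-uniform part: survival probability `p³`). -/
noncomputable def distinctBad (q n : ℕ) {Γ : Type} (A B C : Γ → Finset ℕ) (T : Finset (Fin n → Γ)) :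
    Finset ((Fin n → Γ) × (Fin n → Γ) × (Fin n → Γ)) := by
  classical
  exact (badTriples q n A B C T).filter fun x => x.1 ≠ x.2.1 ∧ x.2.1 ≠ x.2.2 ∧ x.1 ≠ x.2.2

/-- Homocyclic analogue (for the by-product): bad word triples of a CKSU chart over a base group `H₀`, coordinatewise
solvable (tree `ChartSolvable`). -/
noncomputable def chartBadTriples {H₀ Γ : Type} [AddCommGroup H₀] (A B C : Γ → Finset H₀) {n : ℕ}
    (T : Finset (Fin n → Γ)) : Finset ((Fin n → Γ) × (Fin n → Γ) × (Fin n → Γ)) := by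
  classical
  exact (T ×ˢ T ×ˢ T).filter fun x =>
    ¬ (x.1 = x.2.1 ∧ x.2.1 = x.2.2) ∧ ∀ c : Fin n, ChartSolvable A B C (x.1 c) (x.2.1 c) (x.2.2 c)

/-- see `repeatBad` -/
noncomputable def chartRepeatBad {H₀ Γ : Type} [AddCommGroup H₀] (A B C : Γ → Finset H₀) {n : ℕ}
    (T : Finset (Fin n → Γ)) : Finset ((Fin n → Γ) × (Fin n → Γ) × (Fin n → Γ)) := by
  classical
  exact (chartBadTriples A B C T).filter fun x => x.1 = x.2.1 ∨ x.2.1 = x.2.2 ∨ x.1 = x.2.2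

/-- see `distinctBad` -/
noncomputable def chartDistinctBad {H₀ Γ : Type} [AddCommGroup H₀] (A B C : Γ → Finset H₀) {n : ℕ}
    (T : Finset (Fin n → Γ)) : Finset ((Fin n → Γ) × (Fin n → Γ) × (Fin n → Γ)) := by
  classical
  exact (chartBadTriples A B C T).filter fun x => x.1 ≠ x.2.1 ∧ x.2.1 ≠ x.2.2 ∧ x.1 ≠ x.2.2

/-! ## The would-be stubs as named `Prop`s (`Stmt.*`), used only as hypotheses -/
namespace Stmt

/-- `compileCarryChart` (would-be TOOL, L) — VERBATIM `CyclicCarryCharts.Stmt.stub_carryCompiler` of line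
`cyclic-carry-charts` (one proof serves both): cells below `q`, per-symbol carry-TPP and a local carry-chart USP generate an
`IsSTPP` family in the CYCLIC group `ℤ/qⁿ`, with product cardinalities.  Proof plan: an `IsSTPP` relation between
`digitVal`s is `qⁿ ∣ Σ_c e_c q^c`; unroll it into a carry chain (induction on `c`, carries `|κ| ≤ 2` automatically),
contradict `IsLocalCarryUSP` off the diagonal; on the diagonal `CarrySymbolTPP` at column `0` gives equal digits and
`κ₁ = 0`, induct; cardinalities by injectivity of `digitVal` on digit vectors below `q`. -/
def compileCarryChart : Prop :=
  ∀ (q n : ℕ), 2 ≤ q → ∀ (Γ : Type) (A B C : Γ → Finset ℕ),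
    CellsBelow q A B C → (∀ x, CarrySymbolTPP q A B C x) →
    ∀ (L : ℕ) (row : Fin L → Fin n → Γ), IsLocalCarryUSP q n A B C row →
      IsSTPP (carryLeg q n A row) (carryLeg q n B row) (carryLeg q n C row) ∧
      ∀ i : Fin L, (carryLeg q n A row i).card = ∏ c, (A (row i c)).card ∧
        (carryLeg q n B row i).card = ∏ c, (B (row i c)).card ∧
        (carryLeg q n C row i).card = ∏ c, (C (row i c)).card

/-- `typedDeletion` (would-be ENGINE, M; TRUE, elementary) — **the alteration lemma for a mixed 2/3-uniform violation
hypergraph**: for a finite vertex set `T`, a set `R₂` of non-constant ordered triples of vertices (survival probability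
under `p`-sampling at most `p²`) and a set `R₃` of ordered triples of three DISTINCT vertices (survival probability `p³`),
some `W ⊆ T` contains no triple of `R₂` or `R₃` entirely and has `|W| ≥ p|T| − p²|R₂| − p³|R₃|`.  Proof plan (Erdős'
alteration): sample `S ⊆ T` keeping each vertex independently with probability `p`; `E|S| = p|T|`,
`E #{x ∈ R₂ : x ⊆ S} ≤ p²|R₂|`, `E #{x ∈ R₃ : x ⊆ S} = p³|R₃|`; delete `x.1` for every surviving `x`; take an outcome at
least as good as the mean (in Lean: the weighted average over all `S ⊆ T` with weights `p^{|S|}(1−p)^{|T|−|S|}`, three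
linearity-of-expectation identities, `Finset.exists_le_of_sum_le`).  No tightness, no labels, no coordinate structure. -/
def typedDeletion : Prop :=
  ∀ (α : Type) (T : Finset α) (R₂ R₃ : Finset (α × α × α)) (p : ℝ), 0 ≤ p → p ≤ 1 →
    (∀ x ∈ R₂, x.1 ∈ T ∧ x.2.1 ∈ T ∧ x.2.2 ∈ T ∧ ¬ (x.1 = x.2.1 ∧ x.2.1 = x.2.2)) →
    (∀ x ∈ R₃, x.1 ∈ T ∧ x.2.1 ∈ T ∧ x.2.2 ∈ T ∧ x.1 ≠ x.2.1 ∧ x.2.1 ≠ x.2.2 ∧ x.1 ≠ x.2.2) →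
    ∃ W : Finset α, W ⊆ T ∧ (∀ x ∈ R₂, ¬ (x.1 ∈ W ∧ x.2.1 ∈ W ∧ x.2.2 ∈ W)) ∧
      (∀ x ∈ R₃, ¬ (x.1 ∈ W ∧ x.2.1 ∈ W ∧ x.2.2 ∈ W)) ∧
      p * (T.card : ℝ) - p ^ 2 * (R₂.card : ℝ) - p ^ 3 * (R₃.card : ℝ) ≤ (W.card : ℝ)

/-- `countedCarryCharts` (would-be HEART; DEAD — crux at the base scale up to one bit, census gen 5 N29) — **counted carry charts for every thinness**: for
every `a < 1` ONE carry chart (base `q ≥ 2`, symbol type `Γ`, digit cells below `q`, per-symbol carry-TPP) such that for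
every `η > 0` there are a word length `n`, a finite word set `T` (intended: one TYPE CLASS) on which the leg products are
constant `⟨N, M, N⟩` with `N ≥ 2`, `N^a ≤ M`, and a deletion parameter `p ∈ [0, 1]` satisfying the COUNTED packing
inequality `qⁿ ≤ (p|T| − p²·#repeatBad − p³·#distinctBad)·N^{2+η}`, the two counts being those of the carry automaton
(`badTriples`).  Asymptotically (one chart, `n → ∞`, `|T| = 2^{nH}`, counts `2^{nH₂}`, `2^{nH₃}`): the chart must have
ZERO deletion defect `log₂ q − R_del − 2·E log₂|A| ≤ 0` with `R_del = min(H, 2H − H₂, (3H − H₃)/2)`, the slack `N^η`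
absorbing the `o(n)`; `H₂`, `H₃` are pressures of explicit transfer matrices (card).  Refines the heart of
`cyclic-carry-charts` (`carrySeeds_of`); witnesses for small `η` must use CARRIES (a carry-free chart is shadowed in
`(ℤ/q)ⁿ` and capped at `a ≤ a₀(q)` by Thm B — census gen 2 N11). -/
def countedCarryCharts : Prop :=
  ∀ a : ℝ, 0 ≤ a → a < 1 →
    ∃ (q : ℕ) (Γ : Type) (A B C : Γ → Finset ℕ), 2 ≤ q ∧ CellsBelow q A B C ∧ (∀ x, CarrySymbolTPP q A B C x) ∧
      ∀ η : ℝ, 0 < η → ∃ (n N M : ℕ) (T : Finset (Fin n → Γ)) (p : ℝ), 0 ≤ p ∧ p ≤ 1 ∧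
        (∀ u ∈ T, (∏ c, (A (u c)).card) = N ∧ (∏ c, (B (u c)).card) = M ∧ (∏ c, (C (u c)).card) = N) ∧
        2 ≤ N ∧ (N : ℝ) ^ a ≤ M ∧
        (q : ℝ) ^ n ≤ (p * ((T.card : ℕ) : ℝ) - p ^ 2 * (((repeatBad q n A B C T).card : ℕ) : ℝ)
            - p ^ 3 * (((distinctBad q n A B C T).card : ℕ) : ℝ)) * (N : ℝ) ^ (2 + η)

/-- NOT a registered stub — the heart of line `cyclic-carry-charts` (`CyclicCarryCharts.Stmt.stub_carrySeeds`, verbatim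
over the identical definitions), stated here so that `carrySeeds_of` can record in the kernel that the counted heart
REFINES it. -/
def carrySeeds : Prop :=
  ∀ a : ℝ, 0 ≤ a → a < 1 →
    ∃ (q : ℕ) (Γ : Type) (A B C : Γ → Finset ℕ), 2 ≤ q ∧ CellsBelow q A B C ∧ (∀ x, CarrySymbolTPP q A B C x) ∧
      ∀ η : ℝ, 0 < η → ∃ (n L N M : ℕ) (row : Fin L → Fin n → Γ),
        IsLocalCarryUSP q n A B C row ∧
        (∀ i : Fin L, (∏ c, (A (row i c)).card) = N ∧ (∏ c, (B (row i c)).card) = M ∧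
          (∏ c, (C (row i c)).card) = N) ∧
        2 ≤ N ∧ (N : ℝ) ^ a ≤ M ∧ ((q : ℝ) ^ n) ≤ L * (N : ℝ) ^ (2 + η)

/-- NOT a registered stub — the HOMOCYCLIC counted-chart statement (by-product interface for stmt-14848 / stmt-10647):
a CKSU chart over a finite abelian base group `H₀` with per-symbol TPP and, for every `η`, a counted type class whose
packing inequality is met in `H₀ⁿ`.  Composed below with the tree's PROVED compiler `stub_chartSTPP`. -/
def homocyclicCountedCharts : Prop :=
  ∀ a : ℝ, 0 ≤ a → a < 1 →
    ∃ (H₀ : Type) (_ : AddCommGroup H₀) (_ : Fintype H₀) (_ : DecidableEq H₀) (Γ : Type)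
      (A B C : Γ → Finset H₀), (∀ x, SymbolTPP (A x) (B x) (C x)) ∧
      ∀ η : ℝ, 0 < η → ∃ (n N M : ℕ) (T : Finset (Fin n → Γ)) (p : ℝ), 0 ≤ p ∧ p ≤ 1 ∧
        (∀ u ∈ T, (∏ c, (A (u c)).card) = N ∧ (∏ c, (B (u c)).card) = M ∧ (∏ c, (C (u c)).card) = N) ∧
        2 ≤ N ∧ (N : ℝ) ^ a ≤ M ∧
        ((Fintype.card H₀ : ℝ)) ^ n ≤ (p * ((T.card : ℕ) : ℝ) - p ^ 2 * (((chartRepeatBad A B C T).card : ℕ) : ℝ)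
            - p ^ 3 * (((chartDistinctBad A B C T).card : ℕ) : ℝ)) * (N : ℝ) ^ (2 + η)

end Stmt

/-! ## Compositions (kernel-checked, no sorry) -/

/-- DELETION ⇒ CODES: a counted word set yields a local carry-chart USP of at least the deletion bound, with the same
constant leg products.  (The engine step, generic in the chart.) -/
theorem exists_localCarryUSP_of_counts (hD : Stmt.typedDeletion) {q n : ℕ} {Γ : Type}
    (A B C : Γ → Finset ℕ) (T : Finset (Fin n → Γ)) {p : ℝ} (hp0 : 0 ≤ p) (hp1 : p ≤ 1) :
    ∃ (L : ℕ) (row : Fin L → Fin n → Γ), IsLocalCarryUSP q n A B C row ∧ (∀ i, row i ∈ T) ∧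
      p * ((T.card : ℕ) : ℝ) - p ^ 2 * (((repeatBad q n A B C T).card : ℕ) : ℝ)
        - p ^ 3 * (((distinctBad q n A B C T).card : ℕ) : ℝ) ≤ (L : ℝ) := by
  classical
  have hR₂ : ∀ x ∈ repeatBad q n A B C T,
      x.1 ∈ T ∧ x.2.1 ∈ T ∧ x.2.2 ∈ T ∧ ¬ (x.1 = x.2.1 ∧ x.2.1 = x.2.2) := by
    intro x hx
    simp only [repeatBad, badTriples, Finset.mem_filter, Finset.mem_product] at hx
    exact ⟨hx.1.1.1, hx.1.1.2.1, hx.1.1.2.2, hx.1.2.1⟩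
  have hR₃ : ∀ x ∈ distinctBad q n A B C T,
      x.1 ∈ T ∧ x.2.1 ∈ T ∧ x.2.2 ∈ T ∧ x.1 ≠ x.2.1 ∧ x.2.1 ≠ x.2.2 ∧ x.1 ≠ x.2.2 := by
    intro x hx
    simp only [distinctBad, badTriples, Finset.mem_filter, Finset.mem_product] at hx
    exact ⟨hx.1.1.1, hx.1.1.2.1, hx.1.1.2.2, hx.2⟩
  obtain ⟨W, hWT, hW₂, hW₃, hWcard⟩ :=
    hD (Fin n → Γ) T (repeatBad q n A B C T) (distinctBad q n A B C T) p hp0 hp1 hR₂ hR₃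
  -- enumerate `W`
  let row : Fin W.card → Fin n → Γ := fun i => ((W.equivFin.symm i : W) : Fin n → Γ)
  have hrow_mem : ∀ i, row i ∈ W := fun i => (W.equivFin.symm i).2
  have hrow_inj : Function.Injective row := fun i j hij =>
    W.equivFin.symm.injective (Subtype.ext hij)
  refine ⟨W.card, row, ?_, fun i => hWT (hrow_mem i), by exact_mod_cast hWcard⟩
  intro i j k hne hsol
  by_cases hconst : row i = row j ∧ row j = row k
  · exact hne.elim (fun h => h (hrow_inj hconst.1)) (fun h => h (hrow_inj hconst.2))
  · have hbad : (row i, row j, row k) ∈ badTriples q n A B C T := by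
      simp only [badTriples, Finset.mem_filter, Finset.mem_product]
      exact ⟨⟨hWT (hrow_mem i), hWT (hrow_mem j), hWT (hrow_mem k)⟩, hconst, hsol⟩
    by_cases hrep : row i = row j ∨ row j = row k ∨ row i = row k
    · have hmem : (row i, row j, row k) ∈ repeatBad q n A B C T := by
        simp only [repeatBad, Finset.mem_filter]
        exact ⟨hbad, hrep⟩
      exact hW₂ _ hmem ⟨hrow_mem i, hrow_mem j, hrow_mem k⟩
    · have hmem : (row i, row j, row k) ∈ distinctBad q n A B C T := by
        simp only [distinctBad, Finset.mem_filter]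
        push Not at hrep
        exact ⟨hbad, hrep.1, hrep.2.1, hrep.2.2⟩
      exact hW₃ _ hmem ⟨hrow_mem i, hrow_mem j, hrow_mem k⟩

/-- THE COUNTED HEART REFINES THE HEART OF `cyclic-carry-charts`: deletion + counted charts ⇒ carry seeds. -/
theorem carrySeeds_of : Stmt.typedDeletion → Stmt.countedCarryCharts → Stmt.carrySeeds := by
  intro hD hH a ha0 ha1
  obtain ⟨q, Γ, A, B, C, hq, hcells, htpp, hall⟩ := hH a ha0 ha1
  refine ⟨q, Γ, A, B, C, hq, hcells, htpp, fun η hη => ?_⟩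
  obtain ⟨n, N, M, T, p, hp0, hp1, hcard, hN, hM, hhost⟩ := hall η hη
  obtain ⟨L, row, hU, hmem, hL⟩ := exists_localCarryUSP_of_counts hD A B C T hp0 hp1
  refine ⟨n, L, N, M, row, hU, fun i => hcard (row i) (hmem i), hN, hM, ?_⟩
  have hNpos : (0 : ℝ) ≤ (N : ℝ) ^ (2 + η) := by positivity
  exact hhost.trans (mul_le_mul_of_nonneg_right hL hNpos)

/-- COMPILER + SEEDS ⇒ crux (the composition of line `cyclic-carry-charts`, over the identical definitions). -/
theorem thinPackings_of_carrySeeds : Stmt.compileCarryChart → Stmt.carrySeeds → ThinPackings := by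
  intro hC hS a ha0 ha1 η hη
  obtain ⟨q, Γ, A, B, C, hq, hcells, htpp, hall⟩ := hS a ha0 ha1
  obtain ⟨n, L, N, M, row, hU, hcard, hN, hM, hhost⟩ := hall η hη
  obtain ⟨hstpp, hcards⟩ := hC q n hq Γ A B C hcells htpp L row hU
  haveI : NeZero (q ^ n) := ⟨pow_ne_zero _ (by omega)⟩
  refine ⟨ZMod (q ^ n), inferInstance, inferInstance, L, N, M, carryLeg q n A row, carryLeg q n B row,
    carryLeg q n C row, hstpp, ?_, hN, hM, ?_⟩
  · intro i
    obtain ⟨h1, h2, h3⟩ := hcards i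
    obtain ⟨g1, g2, g3⟩ := hcard i
    exact ⟨h1.trans g1, h2.trans g2, h3.trans g3⟩
  · rw [ZMod.card]
    push_cast
    exact hhost

/-- Compiler + deletion engine + counted carry charts ⇒ `ThinBlockAlpha.ThinPackings` (host `H := ZMod (q^n)`) — the
composition the line would have registered; kept as the typed record of the attempt. -/
theorem thinPackings_of :
    Stmt.compileCarryChart → Stmt.typedDeletion → Stmt.countedCarryCharts → ThinPackings :=
  fun hC hD hH => thinPackings_of_carrySeeds hC (carrySeeds_of hD hH)

/-! ## By-product: the engine composed with the PROVED homocyclic compiler (CKSU Thm 37, tree `stub_chartSTPP`) -/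

/-- DELETION ⇒ CODES, homocyclic version: a counted word set over a CKSU chart yields a local chart-USP (tree
`IsLocalChartUSP`) of at least the deletion bound. -/
theorem exists_localChartUSP_of_counts (hD : Stmt.typedDeletion) {H₀ Γ : Type} [AddCommGroup H₀]
    (A B C : Γ → Finset H₀) {n : ℕ} (T : Finset (Fin n → Γ)) {p : ℝ} (hp0 : 0 ≤ p) (hp1 : p ≤ 1) :
    ∃ (L : ℕ) (row : Fin L → Fin n → Γ), IsLocalChartUSP A B C row ∧ (∀ i, row i ∈ T) ∧
      p * ((T.card : ℕ) : ℝ) - p ^ 2 * (((chartRepeatBad A B C T).card : ℕ) : ℝ)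
        - p ^ 3 * (((chartDistinctBad A B C T).card : ℕ) : ℝ) ≤ (L : ℝ) := by
  classical
  have hR₂ : ∀ x ∈ chartRepeatBad A B C T,
      x.1 ∈ T ∧ x.2.1 ∈ T ∧ x.2.2 ∈ T ∧ ¬ (x.1 = x.2.1 ∧ x.2.1 = x.2.2) := by
    intro x hx
    simp only [chartRepeatBad, chartBadTriples, Finset.mem_filter, Finset.mem_product] at hx
    exact ⟨hx.1.1.1, hx.1.1.2.1, hx.1.1.2.2, hx.1.2.1⟩
  have hR₃ : ∀ x ∈ chartDistinctBad A B C T,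
      x.1 ∈ T ∧ x.2.1 ∈ T ∧ x.2.2 ∈ T ∧ x.1 ≠ x.2.1 ∧ x.2.1 ≠ x.2.2 ∧ x.1 ≠ x.2.2 := by
    intro x hx
    simp only [chartDistinctBad, chartBadTriples, Finset.mem_filter, Finset.mem_product] at hx
    exact ⟨hx.1.1.1, hx.1.1.2.1, hx.1.1.2.2, hx.2⟩
  obtain ⟨W, hWT, hW₂, hW₃, hWcard⟩ :=
    hD (Fin n → Γ) T (chartRepeatBad A B C T) (chartDistinctBad A B C T) p hp0 hp1 hR₂ hR₃
  let row : Fin W.card → Fin n → Γ := fun i => ((W.equivFin.symm i : W) : Fin n → Γ)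
  have hrow_mem : ∀ i, row i ∈ W := fun i => (W.equivFin.symm i).2
  have hrow_inj : Function.Injective row := fun i j hij =>
    W.equivFin.symm.injective (Subtype.ext hij)
  refine ⟨W.card, row, ?_, fun i => hWT (hrow_mem i), by exact_mod_cast hWcard⟩
  intro i j k hne
  by_contra hall
  push Not at hall
  by_cases hconst : row i = row j ∧ row j = row k
  · exact hne.elim (fun h => h (hrow_inj hconst.1)) (fun h => h (hrow_inj hconst.2))
  · have hbad : (row i, row j, row k) ∈ chartBadTriples A B C T := by
      simp only [chartBadTriples, Finset.mem_filter, Finset.mem_product]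
      exact ⟨⟨hWT (hrow_mem i), hWT (hrow_mem j), hWT (hrow_mem k)⟩, hconst, hall⟩
    by_cases hrep : row i = row j ∨ row j = row k ∨ row i = row k
    · have hmem : (row i, row j, row k) ∈ chartRepeatBad A B C T := by
        simp only [chartRepeatBad, Finset.mem_filter]
        exact ⟨hbad, hrep⟩
      exact hW₂ _ hmem ⟨hrow_mem i, hrow_mem j, hrow_mem k⟩
    · have hmem : (row i, row j, row k) ∈ chartDistinctBad A B C T := by
        simp only [chartDistinctBad, Finset.mem_filter]
        push Not at hrep
        exact ⟨hbad, hrep.1, hrep.2.1, hrep.2.2⟩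
      exact hW₃ _ hmem ⟨hrow_mem i, hrow_mem j, hrow_mem k⟩

/-- BY-PRODUCT (sorry-free MODULO THE DELETION LEMMA ONLY): homocyclic counted charts ⇒ the crux, through the tree's
PROVED CKSU compiler `stub_chartSTPP` and `|H₀ⁿ| = |H₀|ⁿ`.  Offered to stmt-14848 / stmt-10647 as their compiler∘engine. -/
theorem thinPackings_of_homocyclicCounts :
    Stmt.typedDeletion → Stmt.homocyclicCountedCharts → ThinPackings := by
  intro hD hH a ha0 ha1 η hη
  obtain ⟨H₀, instG, instF, instD, Γ, A, B, C, htpp, hall⟩ := hH a ha0 ha1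
  obtain ⟨n, N, M, T, p, hp0, hp1, hcard, hN, hM, hhost⟩ := hall η hη
  obtain ⟨L, row, hU, hmem, hL⟩ := exists_localChartUSP_of_counts hD A B C T hp0 hp1
  have hstpp := stub_chartSTPP H₀ Γ A B C htpp n L row hU
  refine ⟨(Fin n → H₀), inferInstance, inferInstance, L, N, M,
    (fun i => Fintype.piFinset fun c => A (row i c)), (fun i => Fintype.piFinset fun c => B (row i c)),
    (fun i => Fintype.piFinset fun c => C (row i c)), hstpp, ?_, hN, hM, ?_⟩
  · intro i
    obtain ⟨g1, g2, g3⟩ := hcard (row i) (hmem i)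
    simp only [Fintype.card_piFinset]
    exact ⟨g1, g2, g3⟩
  · have hNpos : (0 : ℝ) ≤ (N : ℝ) ^ (2 + η) := by positivity
    have hcardH : (Fintype.card (Fin n → H₀) : ℝ) = (Fintype.card H₀ : ℝ) ^ n := by
      rw [Fintype.card_fun, Fintype.card_fin]; push_cast; ring
    rw [hcardH]
    exact hhost.trans (mul_le_mul_of_nonneg_right hL hNpos)

end Summit.MatrixMultiplication.MatrixMultiplication.Cruxes.ThinPackings.CensusP5
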